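import Summits.ResolutionOfSingularities.ResolutionOfSingularities.Theorems.WeightedInvariantContactLevelE2DimTwo
import HarnessLib

/-!
# The specimen «E2» `x³ + y⁴z⁴ + y⁷`: the pair `(ord, b_max) = (3, 2)` STALLS under the `(2,1,1)`-weighted blow-up

Topic: `Summits/ResolutionOfSingularities/ResolutionOfSingularities/Theorems`. Helper for the door item
`HypersurfaceCentreConstruction` (statement `stmt-ResolutionOfSingularities-19897`, route `WeightedInvariant`), line
`local-engine` of res-L1-w43-plan-1 (L W4.3), regime P3 (positions of Krull dimension `3`): KERNEL CERTIFICATE of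
res-type-078's engine finding «E2» (`plan/tools/res-type-078/p3/IOTA3-INPUT.md` v1.1 §0 (v) / §7; CHAIN w43 v4.19
§(2) FINDINGS OF RECORD; ORDER (o31) probe row `E2`): the char-free DIM-3 STALL — «`x³ + y⁴z⁴ + y⁷` has `b_max = 2`,
the floor point-centre `(2,1,1)` leads at `[y : z] = [0 : 1]` to `x′³ + z′²y′⁴ + z′y′⁷` with `ι = (3, 2)` again».
Sibling of res-type-057's E8 certificate (`…ContactLevelE8`: the pair RISES at a tame isolated surface point); the
QUOTIENT METHOD is res-type-098's (part 1 `…ContactLevelQuotient`, p527533), imported by name.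

[OURS · L1 W4.3] Replaces the role of NO printed item; NOT a statement of the manuscript
[claim: Hironaka2017, status: under-review]. AI work, weaker than expert review. The objects `contactFiltration`,
`Reaches`, `bMax`, `IsMonomialType` are res-type-092's (`…ContactCentreFiltration`, ORDER (o24-D)); this file only
EVALUATES them on two explicit elements. Numbers only — no word on the P3 design.

## Content (namespace `ContactLevelE2`)

Everything is stated over an ABSTRACT regular local ring of Krull dimension `3` with a named regular system of
parameters `Ideal.span {x, y, z} = 𝔪` — any residue field, any characteristic (`k[x,y,z]_{(x,y,z)}`, `k⟦x,y,z⟧` are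
instances).

* Inputs by name: res-type-098's part 1 `…ContactLevelQuotient` (p527533: `mk_mem_pow_of_mem_contactFiltration` — level
  `n` of `contactFiltration g b ·` maps into `𝔪̄ⁿ` of `S/(g)`; `maximalIdeal_quotient_eq_span₃`; `adicOrder_pow_of_not_mem_sq`)
  and part 1 of this certificate `…ContactLevelE2DimTwo` (the two order computations in the regular local ring `S/(g)` of
  dimension `2` with `𝔪̄ = (x̄, ȳ, z̄)`: `not_mem_pow_nine_origin : x̄³ + ȳ⁴z̄⁴ + ȳ⁷ ∉ 𝔪̄⁹` by the order valuation, and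
  `not_mem_pow_nine_chart : x̄³ + ȳ⁴z̄² + ȳ⁷z̄ ∉ 𝔪̄⁹`, whose order-`6` tie is broken by quasi-regularity, Matsumura 17.10).
* The specimen (§2): **`adicOrder_E2 : ord (x³ + y⁴z⁴ + y⁷) = 3`**, `reaches_two_E2` (`g = x`: `x³ ∈ (x³)`, `y⁴z⁴, y⁷ ∈
  𝔪⁶`), **`not_reaches_E2 : ¬ Reaches _ 3 b` for `b ≥ 3`**, **`bMax_E2 : b_max = 2`**, `not_isMonomialType_E2` — so
  res-type-092's centre filtration at this position is `jContact` with the contact parameter `x` of weight `b_max = 2`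
  and transversal weight `1`, i.e. the weighted centre `(x^{1/2}, y, z)`.
* The chart (§3): `zChart_E2` — the `z`-chart of the `(2,1,1)`-weighted blow-up, `x = x′z′²`, `y = y′z′`, `z = z′`, as a
  RING IDENTITY `(x′z′²)³ + (y′z′)⁴z′⁴ + (y′z′)⁷ = z′⁶ · (x′³ + y′⁴z′² + y′⁷z′)` (weight-one chart, no `μ`-action); for the
  strict transform `g₁ = x³ + y⁴z² + y⁷z`: **`adicOrder_E2z = 3`, `reaches_two_E2z`, `not_reaches_E2z` (`b ≥ 3`),
  `bMax_E2z : b_max = 2`**, `not_isMonomialType_E2z`.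
* `E2_pair_stalls` — the summary `(ord, b_max) = (3, 2)` before AND after.

## References

* V. Cossart, U. Jannsen, S. Saito, *Desingularization: invariants and strategy*, LNM 2270 (2020), Ch. 8 (first slope
  of the Hironaka polygon / contact exponent). [CossartJannsenSaito2020]
* H. Matsumura, *Commutative Ring Theory* (1986), Thm. 14.2 (quotients by a regular parameter), Thm. 13.4 (Krull),
  Thm. 17.10 (quasi-regularity of a regular system of parameters). [Matsumura1987]
* O. Zariski, P. Samuel, *Commutative Algebra* II, Ch. VIII §1 (the order valuation). [ZariskiSamuel1960]
* res-type-078 `IOTA3-INPUT.md` v1.1 §7 (E2) (hand facts); res-type-098 STATUS 2026-08-27T11:07:40Z / 11:15:13Z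
  (quotient method); res-L1-w43-plan-1 CHAIN w43 v4.19 (OURS, AI planning / hand computations).
-/

noncomputable section

open IsLocalRing Literature.AlgebraicGeometry.Resolution
open Summit.ResolutionOfSingularities.ResolutionOfSingularities.Cruxes.HypersurfaceCentreConstruction.LocalEngine
open Summit.ResolutionOfSingularities.ResolutionOfSingularities.Theorems.ContactLevel

set_option linter.dupNamespace false -- mandated namespace of this single-conjunct summit

namespace Summit.ResolutionOfSingularities.ResolutionOfSingularities.Theorems.ContactLevelE2

universe u

/-! ## §2 The specimen E2 `x³ + y⁴z⁴ + y⁷` in a regular local ring of dimension three -/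

section E2

variable {S : Type u} [CommRing S] [IsRegularLocalRing S] {x y z : S}

/-- **`ord (x³ + y⁴z⁴ + y⁷) = 3`** (`ord x³ = 3 < 7 ≤ ord (y⁴z⁴ + y⁷)`). [cite: ZariskiSamuel1960, Ch. VIII §1 Thm. 1] -/
theorem adicOrder_E2 (hdim : ringKrullDim S = 3) (h𝔪 : Ideal.span {x, y, z} = maximalIdeal S) :
    adicOrder (x ^ 3 + y ^ 4 * z ^ 4 + y ^ 7) = 3 := by
  have hx : x ∈ maximalIdeal S := h𝔪 ▸ Ideal.subset_span (by simp)
  have hy : y ∈ maximalIdeal S := h𝔪 ▸ Ideal.subset_span (by simp)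
  have hz : z ∈ maximalIdeal S := h𝔪 ▸ Ideal.subset_span (by simp)
  have hx2 : x ∉ maximalIdeal S ^ 2 := not_mem_sq_of_span_triple_eq h𝔪 hdim
  have h3 : adicOrder (x ^ 3) = 3 := adicOrder_pow_of_not_mem_sq hx hx2 3
  have htail : y ^ 4 * z ^ 4 + y ^ 7 ∈ maximalIdeal S ^ 7 := by
    refine add_mem ?_ (Ideal.pow_mem_pow hy 7)
    have : y ^ 4 * z ^ 4 ∈ maximalIdeal S ^ 8 := by
      rw [show (8 : ℕ) = 4 + 4 from rfl, pow_add]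
      exact Ideal.mul_mem_mul (Ideal.pow_mem_pow hy 4) (Ideal.pow_mem_pow hz 4)
    exact Ideal.pow_le_pow_right (by norm_num) this
  have hlt : adicOrder (x ^ 3) < adicOrder (y ^ 4 * z ^ 4 + y ^ 7) := by
    rw [h3]
    exact lt_of_lt_of_le (by exact_mod_cast (by norm_num : (3 : ℕ) < 7)) ((le_adicOrder_iff _ 7).mpr htail)
  rw [add_assoc, adicOrder_add_eq_left_of_lt hlt, h3]

/-- **Level `2` is reached** by `x³ + y⁴z⁴ + y⁷` with the contact parameter `g = x`: `x³ ∈ (x³)` and `y⁴z⁴, y⁷ ∈ 𝔪⁶`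
(«first slope `≥ 2` in the coordinates `(x; y, z)`»). [cite: CossartJannsenSaito2020, Ch. 8] -/
theorem reaches_two_E2 (hdim : ringKrullDim S = 3) (h𝔪 : Ideal.span {x, y, z} = maximalIdeal S) :
    Reaches (x ^ 3 + y ^ 4 * z ^ 4 + y ^ 7) 3 2 := by
  have hx : x ∈ maximalIdeal S := h𝔪 ▸ Ideal.subset_span (by simp)
  have hy : y ∈ maximalIdeal S := h𝔪 ▸ Ideal.subset_span (by simp)
  have hz : z ∈ maximalIdeal S := h𝔪 ▸ Ideal.subset_span (by simp)
  refine ⟨x, hx, not_mem_sq_of_span_triple_eq h𝔪 hdim, add_mem (add_mem ?_ ?_) ?_⟩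
  · exact span_pow_le_contactFiltration x 2 3 (Ideal.mem_span_singleton_self _)
  · refine pow_le_contactFiltration x 2 (2 * 3) ?_
    show y ^ 4 * z ^ 4 ∈ maximalIdeal S ^ 6
    have : y ^ 4 * z ^ 4 ∈ maximalIdeal S ^ 8 := by
      rw [show (8 : ℕ) = 4 + 4 from rfl, pow_add]
      exact Ideal.mul_mem_mul (Ideal.pow_mem_pow hy 4) (Ideal.pow_mem_pow hz 4)
    exact Ideal.pow_le_pow_right (by norm_num) this
  · refine pow_le_contactFiltration x 2 (2 * 3) ?_
    show y ^ 7 ∈ maximalIdeal S ^ 6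
    exact Ideal.pow_le_pow_right (by norm_num) (Ideal.pow_mem_pow hy 7)

/-- **No level `b ≥ 3` is reached** by `x³ + y⁴z⁴ + y⁷`: for every contact parameter `g ∈ 𝔪 ∖ 𝔪²` the image of `f` in
the regular local ring `S/(g)` of dimension `2` would lie in `𝔪̄^{3b} ⊆ 𝔪̄⁹`, contradicting `not_mem_pow_nine_origin`.
[cite: CossartJannsenSaito2020, Ch. 8] -/
theorem not_reaches_E2 (hdim : ringKrullDim S = 3) (h𝔪 : Ideal.span {x, y, z} = maximalIdeal S)
    {b : ℕ} (hb : 3 ≤ b) : ¬ Reaches (x ^ 3 + y ^ 4 * z ^ 4 + y ^ 7) 3 b := by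
  rintro ⟨g, hg, hg2, hf⟩
  haveI := isLocalRing_quotient (Ideal.span_singleton_ne_top hg)
  obtain ⟨hT, hdimT⟩ := isRegularLocalRing_quotient_and_ringKrullDim_eq_two hdim hg hg2
  haveI := hT
  have hmem := mk_mem_pow_of_mem_contactFiltration hf
  have hmem9 : Ideal.Quotient.mk (Ideal.span {g}) (x ^ 3 + y ^ 4 * z ^ 4 + y ^ 7) ∈
      maximalIdeal (S ⧸ Ideal.span {g}) ^ 9 :=
    Ideal.pow_le_pow_right (show 9 ≤ b * 3 by omega) hmem
  simp only [map_add, map_mul, map_pow] at hmem9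
  exact not_mem_pow_nine_origin hdimT (maximalIdeal_quotient_eq_span₃ h𝔪) hmem9

/-- **E2: `b_max (x³ + y⁴z⁴ + y⁷) = 2`** in every regular local ring of Krull dimension `3` with regular system of
parameters `(x, y, z)`: the integer contact letter reads `2`, the contact parameter is `x`, and res-type-092's centre
filtration `jContact` at this position is the weighted filtration of `(x^{1/2}, y, z)` — weights `(2, 1, 1)` on
`(x, y, z)`. [OURS · L1 W4.3 · E2 certificate] -/
theorem bMax_E2 (hdim : ringKrullDim S = 3) (h𝔪 : Ideal.span {x, y, z} = maximalIdeal S) :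
    bMax (x ^ 3 + y ^ 4 * z ^ 4 + y ^ 7) = 2 := by
  have hord : (adicOrder (x ^ 3 + y ^ 4 * z ^ 4 + y ^ 7)).toNat = 3 := by rw [adicOrder_E2 hdim h𝔪]; rfl
  refine bMax_eq_of_reaches_of_not_reaches_succ (by norm_num) ?_ ?_
  · rw [hord]
    exact reaches_two_E2 hdim h𝔪
  · rw [hord]
    exact not_reaches_E2 hdim h𝔪 le_rfl

/-- `x³ + y⁴z⁴ + y⁷` is NOT of monomial type (not a unit times a power of a regular parameter): such an element of
order `3` would reach every level. [OURS · L1 W4.3 · E2 certificate] -/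
theorem not_isMonomialType_E2 (hdim : ringKrullDim S = 3) (h𝔪 : Ideal.span {x, y, z} = maximalIdeal S) :
    ¬ IsMonomialType (x ^ 3 + y ^ 4 * z ^ 4 + y ^ 7) := by
  rintro ⟨v, g, ν, hv, hg, hg2, hf⟩
  have hord : adicOrder (x ^ 3 + y ^ 4 * z ^ 4 + y ^ 7) = ν := by
    rw [hf, adicOrder_unit_mul_left hv, adicOrder_pow_of_not_mem_sq hg hg2]
  rw [adicOrder_E2 hdim h𝔪] at hord
  have hν : ν = 3 := by exact_mod_cast hord.symm
  subst hν
  refine not_reaches_E2 hdim h𝔪 le_rfl ⟨g, hg, hg2, ?_⟩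
  rw [hf]
  exact Ideal.mul_mem_left _ v (span_pow_le_contactFiltration g 3 3 (Ideal.mem_span_singleton_self _))

end E2

/-! ## §3 The `z`-chart of the `(2,1,1)`-weighted blow-up and the strict transform `x³ + y⁴z² + y⁷z` -/

/-- **The `z`-chart of the weighted blow-up of `(x^{1/2}, y, z)`** (substitution `x = x′z′²`, `y = y′z′`, `z = z′`, the
point `[y : z] = [0 : 1]` of the exceptional divisor): the total transform of `x³ + y⁴z⁴ + y⁷` is `z′⁶` times the
strict transform `x′³ + y′⁴z′² + y′⁷z′` (an identity in every commutative ring). [folklore] -/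
theorem zChart_E2 {R : Type*} [CommRing R] (x' y' z' : R) :
    (x' * z' ^ 2) ^ 3 + (y' * z') ^ 4 * z' ^ 4 + (y' * z') ^ 7 =
      z' ^ 6 * (x' ^ 3 + y' ^ 4 * z' ^ 2 + y' ^ 7 * z') := by
  ring

section E2z

variable {S : Type u} [CommRing S] [IsRegularLocalRing S] {x y z : S}

/-- **`ord (x³ + y⁴z² + y⁷z) = 3`**: the order STALLS at the origin of the `z`-chart. [cite: ZariskiSamuel1960, Ch. VIII §1 Thm. 1] -/
theorem adicOrder_E2z (hdim : ringKrullDim S = 3) (h𝔪 : Ideal.span {x, y, z} = maximalIdeal S) :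
    adicOrder (x ^ 3 + y ^ 4 * z ^ 2 + y ^ 7 * z) = 3 := by
  have hx : x ∈ maximalIdeal S := h𝔪 ▸ Ideal.subset_span (by simp)
  have hy : y ∈ maximalIdeal S := h𝔪 ▸ Ideal.subset_span (by simp)
  have hz : z ∈ maximalIdeal S := h𝔪 ▸ Ideal.subset_span (by simp)
  have hx2 : x ∉ maximalIdeal S ^ 2 := not_mem_sq_of_span_triple_eq h𝔪 hdim
  have h3 : adicOrder (x ^ 3) = 3 := adicOrder_pow_of_not_mem_sq hx hx2 3
  have htail : y ^ 4 * z ^ 2 + y ^ 7 * z ∈ maximalIdeal S ^ 6 := by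
    refine add_mem ?_ ?_
    · rw [show (6 : ℕ) = 4 + 2 from rfl, pow_add]
      exact Ideal.mul_mem_mul (Ideal.pow_mem_pow hy 4) (Ideal.pow_mem_pow hz 2)
    · have : y ^ 7 * z ∈ maximalIdeal S ^ 8 := by
        rw [show (8 : ℕ) = 7 + 1 from rfl, pow_add, pow_one]
        exact Ideal.mul_mem_mul (Ideal.pow_mem_pow hy 7) hz
      exact Ideal.pow_le_pow_right (by norm_num) this
  have hlt : adicOrder (x ^ 3) < adicOrder (y ^ 4 * z ^ 2 + y ^ 7 * z) := by
    rw [h3]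
    exact lt_of_lt_of_le (by exact_mod_cast (by norm_num : (3 : ℕ) < 6)) ((le_adicOrder_iff _ 6).mpr htail)
  rw [add_assoc, adicOrder_add_eq_left_of_lt hlt, h3]

/-- **Level `2` is reached** by `x³ + y⁴z² + y⁷z` with `g = x` (`x³ ∈ (x³)`, `y⁴z² ∈ 𝔪⁶`, `y⁷z ∈ 𝔪⁸`).
[cite: CossartJannsenSaito2020, Ch. 8] -/
theorem reaches_two_E2z (hdim : ringKrullDim S = 3) (h𝔪 : Ideal.span {x, y, z} = maximalIdeal S) :
    Reaches (x ^ 3 + y ^ 4 * z ^ 2 + y ^ 7 * z) 3 2 := by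
  have hx : x ∈ maximalIdeal S := h𝔪 ▸ Ideal.subset_span (by simp)
  have hy : y ∈ maximalIdeal S := h𝔪 ▸ Ideal.subset_span (by simp)
  have hz : z ∈ maximalIdeal S := h𝔪 ▸ Ideal.subset_span (by simp)
  refine ⟨x, hx, not_mem_sq_of_span_triple_eq h𝔪 hdim, add_mem (add_mem ?_ ?_) ?_⟩
  · exact span_pow_le_contactFiltration x 2 3 (Ideal.mem_span_singleton_self _)
  · refine pow_le_contactFiltration x 2 (2 * 3) ?_
    show y ^ 4 * z ^ 2 ∈ maximalIdeal S ^ 6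
    rw [show (6 : ℕ) = 4 + 2 from rfl, pow_add]
    exact Ideal.mul_mem_mul (Ideal.pow_mem_pow hy 4) (Ideal.pow_mem_pow hz 2)
  · refine pow_le_contactFiltration x 2 (2 * 3) ?_
    show y ^ 7 * z ∈ maximalIdeal S ^ 6
    have : y ^ 7 * z ∈ maximalIdeal S ^ 8 := by
      rw [show (8 : ℕ) = 7 + 1 from rfl, pow_add, pow_one]
      exact Ideal.mul_mem_mul (Ideal.pow_mem_pow hy 7) hz
    exact Ideal.pow_le_pow_right (by norm_num) this

/-- **No level `b ≥ 3` is reached** by `x³ + y⁴z² + y⁷z` («not even after `x ↦ x + φ`»): read in `S/(g)` for each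
contact parameter `g` and apply `not_mem_pow_nine_chart` (the tie `ord φ³ = ord y⁴z² = 6` is broken by
quasi-regularity). [cite: Matsumura1987, Thm. 17.10] -/
theorem not_reaches_E2z (hdim : ringKrullDim S = 3) (h𝔪 : Ideal.span {x, y, z} = maximalIdeal S)
    {b : ℕ} (hb : 3 ≤ b) : ¬ Reaches (x ^ 3 + y ^ 4 * z ^ 2 + y ^ 7 * z) 3 b := by
  rintro ⟨g, hg, hg2, hf⟩
  haveI := isLocalRing_quotient (Ideal.span_singleton_ne_top hg)
  obtain ⟨hT, hdimT⟩ := isRegularLocalRing_quotient_and_ringKrullDim_eq_two hdim hg hg2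
  haveI := hT
  have hmem := mk_mem_pow_of_mem_contactFiltration hf
  have hmem9 : Ideal.Quotient.mk (Ideal.span {g}) (x ^ 3 + y ^ 4 * z ^ 2 + y ^ 7 * z) ∈
      maximalIdeal (S ⧸ Ideal.span {g}) ^ 9 :=
    Ideal.pow_le_pow_right (show 9 ≤ b * 3 by omega) hmem
  simp only [map_add, map_mul, map_pow] at hmem9
  exact not_mem_pow_nine_chart hdimT (maximalIdeal_quotient_eq_span₃ h𝔪) hmem9

/-- **E2, `z`-chart: `b_max (x³ + y⁴z² + y⁷z) = 2`** — the same value as before the blow-up. [OURS · L1 W4.3 · E2 certificate] -/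
theorem bMax_E2z (hdim : ringKrullDim S = 3) (h𝔪 : Ideal.span {x, y, z} = maximalIdeal S) :
    bMax (x ^ 3 + y ^ 4 * z ^ 2 + y ^ 7 * z) = 2 := by
  have hord : (adicOrder (x ^ 3 + y ^ 4 * z ^ 2 + y ^ 7 * z)).toNat = 3 := by rw [adicOrder_E2z hdim h𝔪]; rfl
  refine bMax_eq_of_reaches_of_not_reaches_succ (by norm_num) ?_ ?_
  · rw [hord]
    exact reaches_two_E2z hdim h𝔪
  · rw [hord]
    exact not_reaches_E2z hdim h𝔪 le_rfl

/-- `x³ + y⁴z² + y⁷z` is NOT of monomial type. [OURS · L1 W4.3 · E2 certificate] -/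
theorem not_isMonomialType_E2z (hdim : ringKrullDim S = 3) (h𝔪 : Ideal.span {x, y, z} = maximalIdeal S) :
    ¬ IsMonomialType (x ^ 3 + y ^ 4 * z ^ 2 + y ^ 7 * z) := by
  rintro ⟨v, g, ν, hv, hg, hg2, hf⟩
  have hord : adicOrder (x ^ 3 + y ^ 4 * z ^ 2 + y ^ 7 * z) = ν := by
    rw [hf, adicOrder_unit_mul_left hv, adicOrder_pow_of_not_mem_sq hg hg2]
  rw [adicOrder_E2z hdim h𝔪] at hord
  have hν : ν = 3 := by exact_mod_cast hord.symm
  subst hν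
  refine not_reaches_E2z hdim h𝔪 le_rfl ⟨g, hg, hg2, ?_⟩
  rw [hf]
  exact Ideal.mul_mem_left _ v (span_pow_le_contactFiltration g 3 3 (Ideal.mem_span_singleton_self _))

end E2z

/-! ## §4 Summary -/

/-- **E2: the pair `(ord, b_max)` STALLS, every characteristic.**  For `f = x³ + y⁴z⁴ + y⁷` in a regular local ring
`S` of dimension `3` with regular system `(x, y, z)`, and its strict transform `g₁ = x′³ + y′⁴z′² + y′⁷z′` at the origin
of the `z`-chart of the `(2,1,1)`-weighted blow-up (`zChart_E2`), read in a regular local ring `S′` of dimension `3`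
with regular system `(x′, y′, z′)`: `(ord f, b_max f) = (ord g₁, b_max g₁) = (3, 2)` — res-type-078's engine row E2
«`(3,2) → (3,2)` STALL at a dim-3 closed point» in the kernel. [OURS · L1 W4.3 · E2 certificate] -/
theorem E2_pair_stalls {S : Type u} [CommRing S] [IsRegularLocalRing S] {x y z : S}
    (hdim : ringKrullDim S = 3) (h𝔪 : Ideal.span {x, y, z} = maximalIdeal S)
    {S' : Type u} [CommRing S'] [IsRegularLocalRing S'] {x' y' z' : S'}
    (hdim' : ringKrullDim S' = 3) (h𝔪' : Ideal.span {x', y', z'} = maximalIdeal S') :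
    adicOrder (x ^ 3 + y ^ 4 * z ^ 4 + y ^ 7) = 3 ∧ bMax (x ^ 3 + y ^ 4 * z ^ 4 + y ^ 7) = 2 ∧
      adicOrder (x' ^ 3 + y' ^ 4 * z' ^ 2 + y' ^ 7 * z') = 3 ∧
        bMax (x' ^ 3 + y' ^ 4 * z' ^ 2 + y' ^ 7 * z') = 2 :=
  ⟨adicOrder_E2 hdim h𝔪, bMax_E2 hdim h𝔪, adicOrder_E2z hdim' h𝔪', bMax_E2z hdim' h𝔪'⟩

end Summit.ResolutionOfSingularities.ResolutionOfSingularities.Theorems.ContactLevelE2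

end
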